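import Mathlib

/-!
# ValiantsHypothesis / RigidityForcesSymmetry — crux `LaplaceOptimalFive` (stmt-ValiantsHypothesis-24813), crux idea
`young-shadow` (K1, the side-symmetric sector), sketch `Cruxes/LaplaceOptimalFive/YoungShadowSketch.lean` §2:
the CATALECTICANT STEP `stub_symmetricPieces_needTen`, closed by name.

If `P₅ = [v injective]` is written as a sum of split terms `u t ⊗ w t` on PAIR splits `S t`, cylindrical (the short factor reads
`S t`, the long factor reads `(S t)ᶜ`), and every Young shadow `Z_A = Σ_{t : S t = A} u t ⊗ w t` is FULLY slot-symmetric, then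
there are at least `10` terms.  Proof (the card's transport + flattening): choose for every pair `A = {p,q}` a slot permutation
`σ_A` with `σ_A p = 0`, `σ_A q = 1`; full symmetry gives `P₅(v) = Σ_A Z_A(v ∘ σ_A) = Σ_t u t (v ∘ σ_{S t}) · w t (v ∘ σ_{S t})`, a
decomposition all of whose terms are cylindrical on the single split `{0,1} | {2,3,4}`; the ten row functions
`v ↦ [(a, b, v 2, v 3, v 4) injective]` (`a < b`) are linearly independent (dual test words) and lie in the span of the `|T|`
functions `v ↦ w t (v ∘ σ_{S t})`, so `10 ≤ |T|` (the `2|3` flattening of `P₅` has rank `C(5,2) = 10`; catalecticant of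
`x₀x₁x₂x₃x₄`, Ranestad–Schreyer / Carlini–Catalisano–Geramita).

`symmetricPieces_needTen` is the sketch's `stub_symmetricPieces_needTen` with its vocabulary (`IsSplitDecomposition`,
`SlotInvariantOn univ`) UNFOLDED, so the sketch / line closes the stub by `exact`.

Honest framing.  A closed classical step of K1 (`SideSymLaplaceOptimalFive`); K1 itself, Prop A on three splits
(`stub_threeSplit_separation`), `LaplaceOptimalFive` (stmt-24813, OPEN · CONTESTED 72/120), `RankRigidMinimalRepr` and `VP ≠ VNP`
are NOT proved here.  No definitions, no `sorry`; Mathlib only.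
-/

set_option linter.dupNamespace false

namespace Summit.ValiantsHypothesis.ValiantsHypothesis.Theorems.RigidityForcesSymmetryRankRigidMinimalRepr

namespace LaplaceFiveSymmetricPieces

open Finset

/-- A slot permutation sending a given ordered pair of distinct slots to `(0, 1)`. [folklore] -/
theorem exists_perm_pair (p q : Fin 5) (hpq : p ≠ q) : ∃ σ : Equiv.Perm (Fin 5), σ p = 0 ∧ σ q = 1 := by
  refine ⟨Equiv.swap 1 (Equiv.swap 0 p q) * Equiv.swap 0 p, ?_, ?_⟩
  · have hj : Equiv.swap (0 : Fin 5) p q ≠ 0 := by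
      intro h
      have : q = p := by
        have := congrArg (Equiv.swap (0 : Fin 5) p) h
        rwa [Equiv.swap_apply_self, Equiv.swap_apply_left] at this
      exact hpq this.symm
    rw [Equiv.Perm.mul_apply, Equiv.swap_apply_right]
    exact Equiv.swap_apply_of_ne_of_ne (by decide) hj.symm
  · rw [Equiv.Perm.mul_apply, Equiv.swap_apply_right]

/-- For every pair of slots there is a slot permutation mapping it onto `{0, 1}` and its complement onto `{2, 3, 4}`. [folklore] -/
theorem exists_perm_of_card_two (A : Finset (Fin 5)) :
    ∃ σ : Equiv.Perm (Fin 5), A.card = 2 →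
      (∀ i ∈ A, σ i = 0 ∨ σ i = 1) ∧ (∀ i, i ∉ A → σ i ≠ 0 ∧ σ i ≠ 1) := by
  classical
  by_cases hA : A.card = 2
  · obtain ⟨p, q, hpq, rfl⟩ := Finset.card_eq_two.mp hA
    obtain ⟨σ, hp, hq⟩ := exists_perm_pair p q hpq
    refine ⟨σ, fun _ => ⟨?_, ?_⟩⟩
    · intro i hi
      simp only [Finset.mem_insert, Finset.mem_singleton] at hi
      rcases hi with rfl | rfl
      · exact Or.inl hp
      · exact Or.inr hq
    · intro i hi
      simp only [Finset.mem_insert, Finset.mem_singleton, not_or] at hi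
      refine ⟨fun h => hi.1 (σ.injective (h.trans hp.symm)), fun h => hi.2 (σ.injective (h.trans hq.symm))⟩
  · exact ⟨1, fun h => absurd h hA⟩

/-- The ten ordered slot-letter pairs `a < b` and their dual test words. [folklore] -/
theorem rows_dual :
    ∀ k l : Fin 10,
      (Function.Injective (fun i : Fin 5 =>
          if i = 0 then ((![(0 : Fin 5), 0, 0, 0, 1, 1, 1, 2, 2, 3] : Fin 10 → Fin 5) k)
          else if i = 1 then ((![(1 : Fin 5), 2, 3, 4, 2, 3, 4, 3, 4, 4] : Fin 10 → Fin 5) k)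
          else ((![![0, 1, 2, 3, 4], ![0, 2, 1, 3, 4], ![0, 3, 1, 2, 4], ![0, 4, 1, 2, 3], ![1, 2, 0, 3, 4],
                   ![1, 3, 0, 2, 4], ![1, 4, 0, 2, 3], ![2, 3, 0, 1, 4], ![2, 4, 0, 1, 3], ![3, 4, 0, 1, 2]]
                  : Fin 10 → Fin 5 → Fin 5) l) i)) ↔ k = l := by
  decide

variable {N : ℕ}

/-- **The catalecticant step of young-shadow's K1** (`stub_symmetricPieces_needTen`, vocabulary unfolded): a split
decomposition of `P₅` into pair terms whose Young shadows are all fully slot-symmetric has at least ten terms. [folklore] -/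
theorem symmetricPieces_needTen (N : ℕ) (T : Finset (Fin N)) (S : Fin N → Finset (Fin 5))
    (u w : Fin N → (Fin 5 → Fin 5) → ℂ)
    (hdec : (∀ t, ∀ v v' : Fin 5 → Fin 5, (∀ i ∈ S t, v i = v' i) → u t v = u t v') ∧
      (∀ t, ∀ v v' : Fin 5 → Fin 5, (∀ i, i ∉ S t → v i = v' i) → w t v = w t v') ∧
      (∀ v : Fin 5 → Fin 5, (∑ t ∈ T, u t v * w t v) = if Function.Injective v then 1 else 0))
    (hpair : ∀ t ∈ T, (S t).card = 2)
    (hsymm : ∀ A : Finset (Fin 5), ∀ τ : Equiv.Perm (Fin 5), (∀ i, i ∉ (Finset.univ : Finset (Fin 5)) → τ i = i) →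
      ∀ v : Fin 5 → Fin 5, (∑ t ∈ T.filter (fun t => S t = A), u t (v ∘ ⇑τ) * w t (v ∘ ⇑τ))
        = ∑ t ∈ T.filter (fun t => S t = A), u t v * w t v) :
    10 ≤ T.card := by
  classical
  obtain ⟨hu, hw, hid⟩ := hdec
  -- transport every shadow to the split `{0,1} | {2,3,4}`
  choose σ hσ using exists_perm_of_card_two
  have htrans : ∀ v : Fin 5 → Fin 5,
      ∑ t ∈ T, u t (v ∘ ⇑(σ (S t))) * w t (v ∘ ⇑(σ (S t))) = if Function.Injective v then 1 else 0 := by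
    intro v
    rw [← hid v]
    rw [← Finset.sum_fiberwise_of_maps_to (g := S) (fun t (ht : t ∈ T) => Finset.mem_image_of_mem S ht),
      ← Finset.sum_fiberwise_of_maps_to (g := S) (fun t (ht : t ∈ T) => Finset.mem_image_of_mem S ht)]
    refine Finset.sum_congr rfl fun A _ => ?_
    rw [← hsymm A (σ A) (fun i hi => absurd (Finset.mem_univ i) hi) v]
    refine Finset.sum_congr rfl fun t ht => ?_
    rw [(Finset.mem_filter.mp ht).2]
  -- the ambient space of functions on words, the long-side functions, and the ten row functions
  set G : Fin N → ((Fin 5 → Fin 5) → ℂ) := fun t v => w t (v ∘ ⇑(σ (S t))) with hG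
  set ea : Fin 10 → Fin 5 := ![0, 0, 0, 0, 1, 1, 1, 2, 2, 3] with hea
  set eb : Fin 10 → Fin 5 := ![1, 2, 3, 4, 2, 3, 4, 3, 4, 4] with heb
  set tv : Fin 10 → Fin 5 → Fin 5 := ![![0, 1, 2, 3, 4], ![0, 2, 1, 3, 4], ![0, 3, 1, 2, 4], ![0, 4, 1, 2, 3],
    ![1, 2, 0, 3, 4], ![1, 3, 0, 2, 4], ![1, 4, 0, 2, 3], ![2, 3, 0, 1, 4], ![2, 4, 0, 1, 3], ![3, 4, 0, 1, 2]] with htv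
  set R : Fin 10 → ((Fin 5 → Fin 5) → ℂ) := fun k v =>
    if Function.Injective (fun i : Fin 5 => if i = 0 then ea k else if i = 1 then eb k else v i) then 1 else 0 with hR
  have hdual : ∀ k l : Fin 10, R k (tv l) = if k = l then 1 else 0 := by
    intro k l
    simp only [hR]
    by_cases hkl : k = l
    · rw [if_pos hkl, if_pos ((rows_dual k l).mpr hkl)]
    · rw [if_neg hkl, if_neg (fun h => hkl ((rows_dual k l).mp h))]
  -- the rows are linearly independent
  have hli : LinearIndependent ℂ R := by
    rw [Fintype.linearIndependent_iff]
    intro g hg k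
    have := congrFun hg (tv k)
    simp only [Finset.sum_apply, Pi.smul_apply, smul_eq_mul, Pi.zero_apply, hdual] at this
    simpa using this
  -- every row lies in the span of the long-side functions
  have hrow : ∀ k : Fin 10, R k ∈ Submodule.span ℂ ((T.image G : Finset ((Fin 5 → Fin 5) → ℂ)) : Set ((Fin 5 → Fin 5) → ℂ)) := by
    intro k
    -- the word with slots `0,1` frozen at `(ea k, eb k)`
    have key : R k = ∑ t ∈ T, (u t ((fun i : Fin 5 => if i = 0 then ea k else if i = 1 then eb k else tv k i) ∘ ⇑(σ (S t))))
        • G t := by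
      funext v
      have h := htrans (fun i : Fin 5 => if i = 0 then ea k else if i = 1 then eb k else v i)
      simp only [hR]
      rw [← h, Finset.sum_apply]
      refine Finset.sum_congr rfl fun t ht => ?_
      simp only [Pi.smul_apply, smul_eq_mul, hG]
      obtain ⟨hin, hout⟩ := hσ (S t) (hpair t ht)
      congr 1
      · -- the short factor is constant along the row
        refine hu t _ _ fun i hi => ?_
        simp only [Function.comp]
        rcases hin i hi with h0 | h1
        · rw [h0]; simp
        · rw [h1]; simp
      · -- the long factor does not see slots `0, 1`
        refine hw t _ _ fun i hi => ?_
        simp only [Function.comp]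
        obtain ⟨h0, h1⟩ := hout i hi
        rw [if_neg h0, if_neg h1]
    rw [key]
    refine Submodule.sum_mem _ fun t ht => Submodule.smul_mem _ _ (Submodule.subset_span ?_)
    exact Finset.mem_coe.mpr (Finset.mem_image_of_mem G ht)
  -- count dimensions
  have h1 : Module.finrank ℂ (Submodule.span ℂ (Set.range R)) = 10 := by
    rw [finrank_span_eq_card hli, Fintype.card_fin]
  have h2 : Submodule.span ℂ (Set.range R)
      ≤ Submodule.span ℂ ((T.image G : Finset ((Fin 5 → Fin 5) → ℂ)) : Set ((Fin 5 → Fin 5) → ℂ)) := by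
    rw [Submodule.span_le]
    rintro _ ⟨k, rfl⟩
    exact hrow k
  have h3 := Submodule.finrank_mono h2
  have h4 : Module.finrank ℂ (Submodule.span ℂ ((T.image G : Finset ((Fin 5 → Fin 5) → ℂ)) : Set ((Fin 5 → Fin 5) → ℂ)))
      ≤ (T.image G).card :=
    finrank_span_finset_le_card (R := ℂ) (M := (Fin 5 → Fin 5) → ℂ) (T.image G)
  have h5 : (T.image G).card ≤ T.card := Finset.card_image_le
  rw [h1] at h3
  omega

end LaplaceFiveSymmetricPieces

end Summit.ValiantsHypothesis.ValiantsHypothesis.Theorems.RigidityForcesSymmetryRankRigidMinimalRepr
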